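import Summits.QuantumFields.YangMills.Theorems.BalabanUVNodesN16SheetDatum
import Summits.QuantumFields.YangMills.Theorems.BalabanUVNodesN16CaptureRunOne
import Summits.QuantumFields.YangMills.Theorems.BalabanUVNodesN16SlotKeyFlatModuli
import HarnessLib

/-!
# Balaban UV nodes, N16 width lane (N07 → N16 in-edge), file 22b: THE SUP KEY's GRADIENT LETTER HAS A FLOOR (and a free ceiling)

Explicit-unit helper of lineage `pub-ymgap-dag-n16-w1` (generation 8), cell `pub-ymgap`, keyed to K3⁸ `stmt-QuantumFields-27366`
(`SpineGivenEndpointR13SepCoPHV`, skeleton v6 b4e55110ab73e679).  `--kind proof --supports stmt-QuantumFields-27366 --as helper`.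
COUNT-NEUTRAL: no statement item is closed, no stub of the v6 skeleton (`stub_rates13HV`, `stub_expansion13HV`) is named or
discharged, node N07 and node N16 are NOT discharged here.

THE KEY.  Files 17–21 of the lineage (`…N16ExpGaugeOfSupData`, `…N16SlotKeyOfSupData`, `…N16PinnedLooseMatchOfSupKey`,
`…N16CaptureRunOne`, `…N16SupKeyRoads`) display node N07's debt to node N16 as ONE gauge-invariant sup inequality with a letter `c`:

  supKey(C, c) := ∀ k, ∀ ε₁ ∈ ]0, C.a₁], ∀ V ∈ sfClass d L N ε₁ 0, ∀ U, IsMinimiser d (sfClass d L N (C.B₃ε₁)) L N (k+1) V U →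
                  ∀ x κ π, ‖Ad_{U(x,κ)} U(∂p_{x+e_κ;π}) − U(∂p_{x;π})‖ ≤ c·ε₁·L^{−3(k+1)}

([Balaban1985Variational] Thm 1 (8)+(10) at the (42)-objects, uniformly in `k`).  File 19 showed the key CONSISTENT on the flat sector for
every `c ≥ 0` (`supKey_on_flatCfg`).  This file proves the first facts about the letter `c` on NON-FLAT data.

## What is proved (sorry-free, classical axioms only)

* (file 22a `…N16SheetDatum`, imported; THEOREMS ONLY) a central unitary unit `w = ζ(ε)·1` at distance EXACTLY `ε` from `1`; THE SHEET DATUM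
  through its two equations (`w` on the `ν₀`-bonds with `N ∣ x_{μ₀}`, `1` elsewhere; in `sfClass ε₁ 0` once `‖w − 1‖ ≤ ε₁`; plaquette `w⁻¹` at
  `N ∣ x_{μ₀}`, `1` at `N ∣ x_{μ₀} − 1`); the covariant chain `‖U(∂p_x) − 1‖ ≤ ‖U(∂p_{x + m e_κ}) − 1‖ + mγ` under the (10)-type letter `γ`.
* §4 ★ `dev_le_of_adjacent_of_covariantStep` (the mechanism at ANY datum with adjacent coarse deviations `≥ t` ∕ `0` and ANY admissible fine
  configuration carrying the (10)-type letter — no minimality) ∕ ★★ `supKey_core_ineq` ∕ `one_le_of_supKey_runOne` ∕ `one_le_of_supKey` ∕ `supKey_letter_floor` ∕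
  `not_supKey_of_lt_floor` — **THE FLOOR**: for `d ≥ 2`, `L ≥ 2`, `N ≥ 3` and
  constants with `L² ≤ C.B₃`, supKey(C, c) forces `1∕(4d+9) ≤ c`; equivalently the key is FALSE for every `c < 1∕(4d+9)` (`1∕25` at `d = 4`).
  MECHANISM (all BY NAME): the sheet datum with `‖w − 1‖ = ε₁` lies in `sfClass ε₁ 0`; a run-1 minimiser `U` over `sfClass (C.B₃ε₁) 1` EXISTS at it
  (dag-n16-w2's `N16SlotKeyFlatModuli.exists_isMinimiser_inflated`: non-emptiness by the slice pullback at radius `L²ε₁ ≤ C.B₃ε₁` + leaf-05's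
  compactness); the `k = 0` instance of the key gives the letter `γ = cε₁∕L³` for `U`; dag-n21-a's TWO-SIDED [Balaban1985Averaging] Prop. 1
  (`N21AveragingOscillation.prop1_twoSided_of_covariantStep`, the tool of g7's file 20) bounds the datum's plaquette deviation `ε₁` at the coarse
  origin by `L²·‖U(∂p_0) − 1‖ + E` and `L²·‖U(∂p_{L e_{μ₀}}) − 1‖` by the datum's deviation `0` one coarse step on `+ E`,
  `E = (2d+4)cε₁ + K(d)(C.B₃ε₁)²`, `K(d) = 2(2d+4)(3d+8) + 14464(d+1)²(d+4)²` (file 20's letter); 22a's chain joins the two fine plaquettes by `L`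
  covariant steps at cost `Lγ`.  Hence `ε₁ ≤ (4d+9)cε₁ + 2K(d)(C.B₃ε₁)²` for every small `ε₁ > 0`, and `ε₁ → 0` gives the floor.
* §5 `supKey_letter_free_ceiling` (over 22a's `covGrad_fhol_le_of_smallField`) — **THE FREE CEILING**: every member of `sfClass (C.B₃ε₁) (k+1)` (no minimality) has
  `‖∇_U U(∂·)‖ ≤ 2C.B₃ε₁L^{−2(k+1)} = (2C.B₃L^{k+1})·ε₁L^{−3(k+1)}`: the key with the k-DEPENDENT letter `c_k = 2C.B₃L^{k+1}` is kinematic — the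
  regularity-side twin of dag-n16-w2's «(8) at the k-dependent radius `B₃(k)`» (`…N16SlotKeyFlatModuli` §1).

NET READING (for dag-n16-e ∕ the planners ∕ cdisprove; no re-cut asked).  The located content of supKey is exactly ONE factor `L^{−(k+1)}` in the
gradient letter, uniformly in `k`, with the constant confined to `1∕(4d+9) ≤ c` (this file) and print-backed at `c = O(B₃R₁M₁)` (g7's
LOCATED-N16-SUPKEY §3); a `stub_supKey F := ∃ C c, …` witness must take `c F ≥ 1∕(4d+9)` whenever `(C F).B₃ ≥ F.L²`; g7 file 20 §7's capture
window `c < (C.B₃ − 1)∕(2d+4)` and this floor are compatible iff `C.B₃ > 1 + (2d+4)∕(4d+9)`.  The hypothesis `L² ≤ C.B₃` only feeds the existence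
of a competitor-free minimiser through the slice pullback (print's `B₃ ≥ 72d³L³B₀` satisfies it); a smoother admissible preimage would lower it
to `C.B₃ ≥ O(1)` — not typed.

HONEST FRAMING.  Hypothesis-free kernel facts about the tree's (42)-objects; the sup key is a DISPLAYED hypothesis (node N07's content) — NOT
proved here, and NOT refuted at any `c ≥ 1∕(4d+9)`; nothing of Bałaban asserted or refuted ([Balaban1985Variational] Thm 1's letter is `B₃M ≫ 1∕25`);
no stub of K3⁸ v6 named or closed; N16 ∕ N07 NOT discharged; counts of record unmoved (typed 28∕28 · discharged 5∕28); one finite four-torus at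
fixed `ε` — NOT ℝ⁴, NOT infinite volume, NOT OS, NOT a mass gap; the YM mass gap (Clay) is NOT proved by any of this — R4 closes the conditional
finite-𝕋⁴ rung `BalabanLadder.UV` only.

Sources: [Balaban1985Averaging] Prop. 1, (42)–(51), pp. 23–26; [Balaban1985Variational] Thm 1 (8)–(10), p. 279.
-/

set_option autoImplicit false

open scoped BigOperators Matrix Matrix.Norms.L2Operator
open NormedSpace

namespace Summit.QuantumFields.YangMills.BalabanUVNodes.N16SupKeyLetterFloor

open Literature.MathematicalPhysics.QuantumFieldTheory.Balaban1983to89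
open B7Prop1Explicit B7Prop2Explicit MatrixLog UnitaryModel
open T4AveragingDeficitWall hiding Site Plane Plaq Bond
open T4AveragingDeficitWallBoundary (IsPeriodicCfg)
open B7Prop1Local (hol_plaqWord_eq)
open Summit.QuantumFields.BalabanUV.T4Continuum
open AveragingDeficitTransport (mem_U1_of_unitary)
open MinimalActionSandwich (IsMinimiser)
open MinimalActionRate (sfClass)
open Summit.QuantumFields.YangMills.Theorems.N21AveragingOscillation (prop1_twoSided_of_covariantStep)
open Summit.QuantumFields.YangMills.BalabanUVNodes.N16SlotKeyFlatModuli (exists_isMinimiser_inflated)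
open Summit.QuantumFields.YangMills.BalabanUVNodes.N16SheetDatum

noncomputable section

variable {d : ℕ} {n : Type} [Fintype n] [DecidableEq n]

/-! ## §4 ★★ THE FLOOR OF THE SUP KEY's GRADIENT LETTER -/

/-- `boxVec` of the zero offset is the zero vector. [folklore] -/
theorem boxVec_const_zero {L : ℕ} (hL : 1 ≤ L) : boxVec L (fun _ : Fin d => (⟨0, by omega⟩ : Fin L)) = 0 := by
  funext κ; simp [boxVec]

/-- ★★ **THE MECHANISM, AT ANY DATUM WITH TWO ADJACENT COARSE PLAQUETTES OF DEVIATIONS `≥ t` AND `0`.**  `d ≥ 2`, `L ≥ 1`, directions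
`μ₀ < ν₀`; a datum `V` whose `(μ₀,ν₀)`-plaquette at the origin deviates from `1` by at least `t` and at `e_{μ₀}` equals `1`; a configuration `U` in the
run-1 class `sfClass d L N ρ 1` averaging to `V` (`avgIter L U 1 = V`) whose covariant plaquette differences are `≤ c·ε₁∕L³`, in the Prop-1 regime
`512(d+1)(d+4)ρ ≤ 1`.  Then `t ≤ (4d+9)·c·ε₁ + 2K(d)·ρ²`, `K(d) = 2(2d+4)(3d+8) + 14464(d+1)²(d+4)²`.  No minimality is used here — it enters only through
the key, which speaks about minimisers.  TOOLS BY NAME: dag-n21-a's two-sided [Balaban1985Averaging] Prop. 1 `N21AveragingOscillation.prop1_twoSided_of_covariantStep`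
((.2) at the origin block: `t ≤ L²‖U(∂p_0) − 1‖ + E`; (.1) at the block of `e_{μ₀}`: `L²‖U(∂p_{Le_{μ₀}}) − 1‖ ≤ 0 + E`), file 22a's covariant chain
(`‖U(∂p_0) − 1‖ ≤ ‖U(∂p_{Le_{μ₀}}) − 1‖ + L·cε₁∕L³`), and file 20's identities for `E = (2d+4)cε₁ + K(d)ρ²`. [cite: Balaban1985Averaging, Prop. 1 (44)–(51) pp.24–26] -/
theorem dev_le_of_adjacent_of_covariantStep [Nonempty n] {L N : ℕ} (hL : 1 ≤ L) {μ₀ ν₀ : Fin d} (hlt : μ₀ < ν₀)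
    {ρ ε₁ c t : ℝ} (hρ : 0 ≤ ρ) (hsmall : 512 * (d + 1) * (d + 4) * ρ ≤ 1)
    {V U : Site d → Fin d → (Matrix n n ℂ)ˣ}
    (hV0 : t ≤ ‖((hol V 0 (plaqWord μ₀ ν₀) : (Matrix n n ℂ)ˣ) : Matrix n n ℂ) - 1‖)
    (hV1 : hol V (e μ₀) (plaqWord μ₀ ν₀) = 1)
    (hU : U ∈ sfClass d L N ρ 1) (havg : avgIter L U 1 = V)
    (hγ : ∀ (x : Site d) (κ : Fin d) (π : T4AveragingDeficitWall.Plane d),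
      ‖covGrad U (fun q => ((fhol U q : (Matrix n n ℂ)ˣ) : Matrix n n ℂ)) x κ π‖ ≤ c * ε₁ / (L : ℝ) ^ 3) :
    t ≤ (4 * d + 9) * c * ε₁ + 2 * (2 * (2 * d + 4) * (3 * d + 8) + 14464 * (d + 1) ^ 2 * (d + 4) ^ 2) * ρ ^ 2 := by
  have hμν : μ₀ ≠ ν₀ := ne_of_lt hlt
  set π₀ : T4AveragingDeficitWall.Plane d := ⟨(μ₀, ν₀), hlt⟩ with hπ₀def
  have hL0 : (0 : ℝ) < L := by exact_mod_cast (show 0 < L by omega)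
  obtain ⟨hUu, -, hUs⟩ := hU
  set γ : ℝ := c * ε₁ / (L : ℝ) ^ 3 with hγdef
  -- the coarse plaquettes of the average ARE the datum's
  have hc : ∀ q : Site d, cplaq L (bavg L U) ((L : ℤ) • q) μ₀ ν₀ = hol V q (plaqWord μ₀ ν₀) := by
    intro q; rw [← hol_rescale_plaqWord, ← avgIter_zero L (bavg L U)]
    rw [show rescale L (avgIter L (bavg L U) 0) = rescale L (bavg L (avgIter L U 0)) by rw [avgIter_zero, avgIter_zero],
      ← avgIter_succ, havg]
  have hc0 : ‖((cplaq L (bavg L U) ((L : ℤ) • (0 : Site d)) μ₀ ν₀ : (Matrix n n ℂ)ˣ) : Matrix n n ℂ) - 1‖ ≥ t := by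
    rw [hc 0]; exact hV0
  have hc1 : ‖((cplaq L (bavg L U) ((L : ℤ) • e μ₀) μ₀ ν₀ : (Matrix n n ℂ)ˣ) : Matrix n n ℂ) - 1‖ = 0 := by
    rw [hc (e μ₀), hV1]; simp
  -- Prop. 1, two-sided, at the two blocks
  have hV1' : ∀ x i, U x i ∈ U1 (Matrix n n ℂ) := fun x i => mem_U1_of_unitary (hUu x i)
  have hα₀ : (0 : ℝ) ≤ ρ / (L : ℝ) ^ 2 := by positivity
  have h44 : ∀ (x : Site d) (i i' : Fin d), i ≠ i' →
      ‖((hol U x (plaqWord i i') : (Matrix n n ℂ)ˣ) : Matrix n n ℂ) - 1‖ ≤ ρ / (L : ℝ) ^ 2 := by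
    intro x i i' hii'; have := hUs x i i' hii'; simpa using this
  have hsmall' : 512 * (d + 1) * (d + 4) * (L : ℝ) ^ 2 * (ρ / (L : ℝ) ^ 2) ≤ 1 := by
    rw [show 512 * ((d : ℝ) + 1) * (d + 4) * (L : ℝ) ^ 2 * (ρ / (L : ℝ) ^ 2) = 512 * (d + 1) * (d + 4) * ρ by field_simp]
    exact hsmall
  have hγ' : ∀ (y : Site d) (j : Fin d),
      ‖((U y j : (Matrix n n ℂ)ˣ) : Matrix n n ℂ) * ((hol U (y + e j) (plaqWord μ₀ ν₀) : (Matrix n n ℂ)ˣ) : Matrix n n ℂ)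
          * (((U y j)⁻¹ : (Matrix n n ℂ)ˣ) : Matrix n n ℂ) - ((hol U y (plaqWord μ₀ ν₀) : (Matrix n n ℂ)ˣ) : Matrix n n ℂ)‖ ≤ γ :=
    fun y j => hγ y j π₀
  set r₀ : Fin d → Fin L := fun _ => ⟨0, by omega⟩ with hr₀def
  have hb0 : boxVec L r₀ = 0 := boxVec_const_zero hL
  have hm0 := (prop1_twoSided_of_covariantStep L hL ((L : ℤ) • (0 : Site d)) hμν U hV1' hα₀ hsmall' h44 hγ' r₀
    (i₀ := 0) (j₀ := 0) (by omega) (by omega)).2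
  have hm1 := (prop1_twoSided_of_covariantStep L hL ((L : ℤ) • e μ₀) hμν U hV1' hα₀ hsmall' h44 hγ' r₀
    (i₀ := 0) (j₀ := 0) (by omega) (by omega)).1
  rw [hb0] at hm0 hm1
  simp only [smul_zero, Nat.cast_zero, zero_smul, add_zero] at hm0 hm1 hc0
  -- the chain of `L` covariant steps from the fine origin to `L·e_{μ₀}`
  have hch := norm_plaqDev_chain hUu π₀ μ₀ (fun x => hγ x μ₀ π₀) L 0
  simp only [zero_add] at hch
  have hf0 : ((fhol U ((0 : Site d), π₀) : (Matrix n n ℂ)ˣ) : Matrix n n ℂ) = hol U 0 (plaqWord μ₀ ν₀) := rfl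
  have hf1 : ((fhol U (((L : ℕ) : ℤ) • e μ₀, π₀) : (Matrix n n ℂ)ˣ) : Matrix n n ℂ) = hol U ((L : ℤ) • e μ₀) (plaqWord μ₀ ν₀) := rfl
  rw [hf0, hf1] at hch
  -- the error term `E = (2d+4)cε₁ + K ρ²`
  have hθ : 8 * ((d : ℝ) + 1) * (d + 4) * (L : ℝ) ^ 2 * (ρ / (L : ℝ) ^ 2) = 8 * (d + 1) * (d + 4) * ρ := by field_simp
  have e1 : (L : ℝ) ^ 2 * (((2 * (d * L) + 4 * L : ℕ) : ℝ)
        * (γ + 2 * (((3 * (d * L) + 8 * L : ℕ) : ℝ) * (ρ / (L : ℝ) ^ 2)) * (ρ / (L : ℝ) ^ 2)))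
      = (2 * d + 4) * c * ε₁ + 2 * (2 * d + 4) * (3 * d + 8) * ρ ^ 2 := by
    rw [hγdef]; push_cast; field_simp
  have e2 : (L : ℝ) ^ 2 * ((L : ℝ) * γ) = c * ε₁ := by rw [hγdef]; field_simp
  rw [hθ, e1] at hm0 hm1
  -- assemble: t ≤ L²D₀ + E ≤ L²(D₁ + Lγ) + E ≤ 2E + cε₁
  have hL2 : (0 : ℝ) ≤ (L : ℝ) ^ 2 := by positivity
  have hstep : (L : ℝ) ^ 2 * ‖((hol U 0 (plaqWord μ₀ ν₀) : (Matrix n n ℂ)ˣ) : Matrix n n ℂ) - 1‖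
      ≤ (L : ℝ) ^ 2 * ‖((hol U ((L : ℤ) • e μ₀) (plaqWord μ₀ ν₀) : (Matrix n n ℂ)ˣ) : Matrix n n ℂ) - 1‖ + c * ε₁ := by
    have := mul_le_mul_of_nonneg_left hch hL2
    rw [mul_add, e2] at this
    exact this
  rw [hc1] at hm1
  have e3 : (226 : ℝ) * (8 * (d + 1) * (d + 4) * ρ) ^ 2 = 14464 * (d + 1) ^ 2 * (d + 4) ^ 2 * ρ ^ 2 := by ring
  rw [e3] at hm0 hm1
  linarith [hm0, hm1, hstep, hc0]

/-- ★★ **THE CORE INEQUALITY AT ONE SMALL `ε₁`.**  `d ≥ 2`, `L ≥ 2`, `N ≥ 3`, constants `C` with `L² ≤ C.B₃`; assume the `k = 0` instance of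
the sup key supKey(C, c) («every minimiser of run 1 over `sfClass (C.B₃ε₁) 1` at an `ε₁`-loose datum has covariant plaquette differences
`≤ c·ε₁∕L³`»).  Then for every `0 < ε₁ ≤ min(C.a₁, 2)` in the series ∕ Prop-1 regime (`512(d+1)(d+4)·C.B₃ε₁ ≤ 1`, `16C₀·C.B₃ε₁ ≤ 3`,
`1024(d+1)(d+4)L²·C.B₃ε₁ ≤ 1`):  `ε₁ ≤ (4d+9)·c·ε₁ + 2K(d)·(C.B₃ε₁)²`.
MECHANISM: the sheet datum of file 22a (plaquette `w⁻¹`, `‖w − 1‖ = ε₁`, at the coarse origin; plaquette `1` one coarse step on in direction `μ₀`) lies in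
`sfClass ε₁ 0` and carries a run-1 minimiser `U` over `sfClass (C.B₃ε₁) 1` (existence at the inflated radius, dag-n16-w2's
`…N16SlotKeyFlatModuli.exists_isMinimiser_inflated`; this is where `L² ≤ C.B₃` is used); the key gives `U` the letter `cε₁∕L³`, and
`dev_le_of_adjacent_of_covariantStep` concludes. [cite: Balaban1985Averaging, Prop. 1 (44)–(51) pp.24–26] -/
theorem supKey_core_ineq [Nonempty n] (hd : 2 ≤ d) {L N : ℕ} (hL : 2 ≤ L) (hN : 3 ≤ N) (C : B11Thm1.Consts)
    (hLB : (L : ℝ) ^ 2 ≤ C.B₃) {c ε₁ : ℝ} (hε : 0 < ε₁) (hε2 : ε₁ ≤ 2) (hεa : ε₁ ≤ C.a₁)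
    (hsmall : 512 * (d + 1) * (d + 4) * (C.B₃ * ε₁) ≤ 1) (he1 : 16 * C0 d * (C.B₃ * ε₁) ≤ 3)
    (he2 : 1024 * (d + 1) * (d + 4) * (L : ℝ) ^ 2 * (C.B₃ * ε₁) ≤ 1)
    (hK : ∀ (ε₁ : ℝ), 0 < ε₁ → ε₁ ≤ C.a₁ → ∀ (V U : Site d → Fin d → (Matrix n n ℂ)ˣ), V ∈ sfClass d L N ε₁ 0 →
      IsMinimiser d (sfClass d L N (C.B₃ * ε₁)) L N 1 V U →
        ∀ (x : Site d) (κ : Fin d) (π : T4AveragingDeficitWall.Plane d),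
          ‖covGrad U (fun q => ((fhol U q : (Matrix n n ℂ)ˣ) : Matrix n n ℂ)) x κ π‖ ≤ c * ε₁ / (L : ℝ) ^ 3) :
    ε₁ ≤ (4 * d + 9) * c * ε₁
      + 2 * (2 * (2 * d + 4) * (3 * d + 8) + 14464 * (d + 1) ^ 2 * (d + 4) ^ 2) * (C.B₃ * ε₁) ^ 2 := by
  -- the two directions
  set μ₀ : Fin d := ⟨0, by omega⟩ with hμ₀def
  set ν₀ : Fin d := ⟨1, by omega⟩ with hν₀def
  have hlt : μ₀ < ν₀ := Fin.mk_lt_mk.mpr zero_lt_one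
  have hμν : μ₀ ≠ ν₀ := ne_of_lt hlt
  have hN2 : 2 ≤ N := by omega
  have hB := C.B₃_pos
  have hρ0 : 0 ≤ C.B₃ * ε₁ := by positivity
  -- the central unit `w` with `‖w − 1‖ = ε₁` and a solution `V` of the sheet equations (file 22a)
  obtain ⟨w, hw, hwn⟩ := exists_central_unitary_norm_sub_one_eq (n := n) hε.le hε2
  have hw1 : w ∈ U1 (Matrix n n ℂ) := mem_U1_of_unitary hw
  obtain ⟨V, hV1, hV2⟩ := exists_sheetEqs (d := d) N μ₀ ν₀ w
  have hV : V ∈ sfClass d L N ε₁ 0 := mem_sfClass_of_sheetEqs L hV1 hV2 hw hwn.le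
  -- its two adjacent coarse plaquettes
  have hV0 : ε₁ ≤ ‖((hol V 0 (plaqWord μ₀ ν₀) : (Matrix n n ℂ)ˣ) : Matrix n n ℂ) - 1‖ := by
    rw [hol_of_sheetEqs_of_dvd hV1 hV2 hN2 hμν (by simp : (N : ℤ) ∣ (0 : Site d) μ₀)]
    have h := norm_inv_sub_one_le ((U1 _).inv_mem hw1)
    rw [inv_inv, hwn] at h
    exact h
  have hVe : hol V (e μ₀) (plaqWord μ₀ ν₀) = 1 :=
    hol_of_sheetEqs_of_dvd_sub_one hV1 hV2 hN hμν (by simp [e_apply] : (N : ℤ) ∣ (e μ₀ : Site d) μ₀ - 1)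
  -- a run-1 minimiser at the sheet datum (existence at the inflated radius `C.B₃ε₁ ≥ L²ε₁`)
  have he : ε₁ * ((L : ℝ) ^ 1) ^ 2 ≤ C.B₃ * ε₁ := by
    rw [pow_one, mul_comm]; exact mul_le_mul_of_nonneg_right hLB hε.le
  obtain ⟨U, hU⟩ := exists_isMinimiser_inflated hL hε.le hV 1 he he1 he2
  exact dev_le_of_adjacent_of_covariantStep (by omega) hlt hρ0 hsmall hV0 hVe hU.mem.1 hU.mem.2 (hK ε₁ hε hεa V U hV hU)

/-- ★★ **THE FLOOR FROM RUN ONE ALONE (product form)**: for `d ≥ 2`, `L ≥ 2`, `N ≥ 3` and constants with `L² ≤ C.B₃`, the `k = 0` instance of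
the sup key already forces `1 ≤ (4d+9)·c`.  From `supKey_core_ineq` as `ε₁ → 0⁺`: `ε₁(1 − (4d+9)c) ≤ 2K(d)C.B₃²ε₁²` for all small `ε₁ > 0`.
[cite: Balaban1985Variational, Thm 1 (8)–(10) p.279] -/
theorem one_le_of_supKey_runOne [Nonempty n] (hd : 2 ≤ d) {L N : ℕ} (hL : 2 ≤ L) (hN : 3 ≤ N) (C : B11Thm1.Consts)
    (hLB : (L : ℝ) ^ 2 ≤ C.B₃) {c : ℝ}
    (hK0 : ∀ (ε₁ : ℝ), 0 < ε₁ → ε₁ ≤ C.a₁ → ∀ (V U : Site d → Fin d → (Matrix n n ℂ)ˣ), V ∈ sfClass d L N ε₁ 0 →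
      IsMinimiser d (sfClass d L N (C.B₃ * ε₁)) L N 1 V U →
        ∀ (x : Site d) (κ : Fin d) (π : T4AveragingDeficitWall.Plane d),
          ‖covGrad U (fun q => ((fhol U q : (Matrix n n ℂ)ˣ) : Matrix n n ℂ)) x κ π‖ ≤ c * ε₁ / (L : ℝ) ^ 3) :
    1 ≤ (4 * d + 9) * c := by
  have hB := C.B₃_pos
  have ha := C.a₁_pos
  have hL0 : (0 : ℝ) < L := by exact_mod_cast (show 0 < L by omega)
  have hC0 := C0_pos d
  set K : ℝ := 2 * (2 * (d : ℝ) + 4) * (3 * d + 8) + 14464 * (d + 1) ^ 2 * (d + 4) ^ 2 with hKdef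
  have hKpos : 0 < K := by positivity
  by_contra hcon
  push Not at hcon
  set δ : ℝ := 1 - (4 * d + 9) * c with hδdef
  have hδ : 0 < δ := by rw [hδdef]; linarith
  -- the thresholds
  set t₁ : ℝ := 1 / (512 * (d + 1) * (d + 4) * C.B₃) with ht₁
  set t₂ : ℝ := 3 / (16 * C0 d * C.B₃) with ht₂
  set t₃ : ℝ := 1 / (1024 * (d + 1) * (d + 4) * (L : ℝ) ^ 2 * C.B₃) with ht₃
  set t₄ : ℝ := δ / (4 * K * C.B₃ ^ 2) with ht₄
  have ht₁0 : 0 < t₁ := by positivity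
  have ht₂0 : 0 < t₂ := by positivity
  have ht₃0 : 0 < t₃ := by positivity
  have ht₄0 : 0 < t₄ := by positivity
  set ε₁ : ℝ := min (min (min C.a₁ 2) (min t₁ t₂)) (min t₃ t₄) with hε₁def
  have hε : 0 < ε₁ := lt_min (lt_min (lt_min ha two_pos) (lt_min ht₁0 ht₂0)) (lt_min ht₃0 ht₄0)
  have hεa : ε₁ ≤ C.a₁ := (min_le_left _ _).trans ((min_le_left _ _).trans (min_le_left _ _))
  have hε2 : ε₁ ≤ 2 := (min_le_left _ _).trans ((min_le_left _ _).trans (min_le_right _ _))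
  have hεt₁ : ε₁ ≤ t₁ := (min_le_left _ _).trans ((min_le_right _ _).trans (min_le_left _ _))
  have hεt₂ : ε₁ ≤ t₂ := (min_le_left _ _).trans ((min_le_right _ _).trans (min_le_right _ _))
  have hεt₃ : ε₁ ≤ t₃ := (min_le_right _ _).trans (min_le_left _ _)
  have hεt₄ : ε₁ ≤ t₄ := (min_le_right _ _).trans (min_le_right _ _)
  have hsmall : 512 * (d + 1) * (d + 4) * (C.B₃ * ε₁) ≤ 1 := by
    have h := (le_div_iff₀ (by positivity : (0 : ℝ) < 512 * (d + 1) * (d + 4) * C.B₃)).mp hεt₁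
    linarith
  have he1 : 16 * C0 d * (C.B₃ * ε₁) ≤ 3 := by
    have h := (le_div_iff₀ (by positivity : (0 : ℝ) < 16 * C0 d * C.B₃)).mp hεt₂
    linarith
  have he2 : 1024 * (d + 1) * (d + 4) * (L : ℝ) ^ 2 * (C.B₃ * ε₁) ≤ 1 := by
    have h := (le_div_iff₀ (by positivity : (0 : ℝ) < 1024 * (d + 1) * (d + 4) * (L : ℝ) ^ 2 * C.B₃)).mp hεt₃
    linarith
  have ht4 : 4 * K * C.B₃ ^ 2 * ε₁ ≤ δ := by
    have h := (le_div_iff₀ (by positivity : (0 : ℝ) < 4 * K * C.B₃ ^ 2)).mp hεt₄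
    linarith
  have hcore := supKey_core_ineq hd hL hN C hLB hε hε2 hεa hsmall he1 he2 hK0
  -- `ε₁ δ ≤ 2 K B² ε₁²` with `4 K B² ε₁ ≤ δ`: contradiction
  have h1 : ε₁ * δ ≤ 2 * K * C.B₃ ^ 2 * ε₁ ^ 2 := by
    rw [hδdef, hKdef]; nlinarith [hcore]
  nlinarith [h1, ht4, hε, hδ, hKpos, hB]

/-- ★★ **THE FLOOR (product form)**: for `d ≥ 2`, `L ≥ 2`, `N ≥ 3` and constants with `L² ≤ C.B₃`, the sup key supKey(C, c) — displayed
VERBATIM as in files 19–21 (all runs `k+1`) — forces `1 ≤ (4d+9)·c` (its `k = 0` instance does, `one_le_of_supKey_runOne`).  The key is node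
N07's content and is NOT asserted here; this is a fact about its letter. [cite: Balaban1985Variational, Thm 1 (8)–(10) p.279] -/
theorem one_le_of_supKey [Nonempty n] (hd : 2 ≤ d) {L N : ℕ} (hL : 2 ≤ L) (hN : 3 ≤ N) (C : B11Thm1.Consts)
    (hLB : (L : ℝ) ^ 2 ≤ C.B₃) {c : ℝ}
    (hK : ∀ (k : ℕ) (ε₁ : ℝ), 0 < ε₁ → ε₁ ≤ C.a₁ → ∀ (V U : Site d → Fin d → (Matrix n n ℂ)ˣ), V ∈ sfClass d L N ε₁ 0 →
      IsMinimiser d (sfClass d L N (C.B₃ * ε₁)) L N (k + 1) V U →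
        ∀ (x : Site d) (κ : Fin d) (π : T4AveragingDeficitWall.Plane d),
          ‖covGrad U (fun q => ((fhol U q : (Matrix n n ℂ)ˣ) : Matrix n n ℂ)) x κ π‖ ≤ c * ε₁ / ((L : ℝ) ^ (k + 1)) ^ 3) :
    1 ≤ (4 * d + 9) * c := by
  refine one_le_of_supKey_runOne (n := n) hd hL hN C hLB fun ε₁ hε hεa V U hV hU x κ π => ?_
  have h := hK 0 ε₁ hε hεa V U hV hU x κ π
  simpa only [zero_add, pow_one] using h

/-- ★★ **THE FLOOR**: under the same hypotheses, `1∕(4d+9) ≤ c` — the gradient letter of supKey(C, c) cannot be smaller than `1∕(4d+9)` (`1∕25` at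
`d = 4`).  Print's letter ([Balaban1985Variational] (10): `B₃Mε₁(L^jη)^{−3}`, `M ≥ R₁M₁ ≥ 1`) is `O(B₃M) ≫ 1∕25`: no tension with print.
[cite: Balaban1985Variational, Thm 1 (8)–(10) p.279] -/
theorem supKey_letter_floor [Nonempty n] (hd : 2 ≤ d) {L N : ℕ} (hL : 2 ≤ L) (hN : 3 ≤ N) (C : B11Thm1.Consts)
    (hLB : (L : ℝ) ^ 2 ≤ C.B₃) {c : ℝ}
    (hK : ∀ (k : ℕ) (ε₁ : ℝ), 0 < ε₁ → ε₁ ≤ C.a₁ → ∀ (V U : Site d → Fin d → (Matrix n n ℂ)ˣ), V ∈ sfClass d L N ε₁ 0 →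
      IsMinimiser d (sfClass d L N (C.B₃ * ε₁)) L N (k + 1) V U →
        ∀ (x : Site d) (κ : Fin d) (π : T4AveragingDeficitWall.Plane d),
          ‖covGrad U (fun q => ((fhol U q : (Matrix n n ℂ)ˣ) : Matrix n n ℂ)) x κ π‖ ≤ c * ε₁ / ((L : ℝ) ^ (k + 1)) ^ 3) :
    1 / (4 * d + 9) ≤ c := by
  have h := one_le_of_supKey hd hL hN C hLB hK
  rw [div_le_iff₀ (by positivity : (0 : ℝ) < 4 * d + 9)]
  linarith

/-- ★ **THE SUP KEY IS FALSE BELOW THE FLOOR**: for `c < 1∕(4d+9)` (in particular `c = 0`, or any `c < 1∕25` at `d = 4`), `d ≥ 2`, `L ≥ 2`, `N ≥ 3`,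
`L² ≤ C.B₃`, the displayed hypothesis supKey(C, c) is REFUTED — compare file 19's `supKey_on_flatCfg` (the conclusion holds at the FLAT datum for
every `c ≥ 0`): the ∀-data key has content that the flat sector does not see.  Nothing is said at or above the floor (node N07's content).
[cite: Balaban1985Variational, Thm 1 (8)–(10) p.279] -/
theorem not_supKey_of_lt_floor [Nonempty n] (hd : 2 ≤ d) {L N : ℕ} (hL : 2 ≤ L) (hN : 3 ≤ N) (C : B11Thm1.Consts)
    (hLB : (L : ℝ) ^ 2 ≤ C.B₃) {c : ℝ} (hc : c < 1 / (4 * d + 9)) :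
    ¬ (∀ (k : ℕ) (ε₁ : ℝ), 0 < ε₁ → ε₁ ≤ C.a₁ → ∀ (V U : Site d → Fin d → (Matrix n n ℂ)ˣ), V ∈ sfClass d L N ε₁ 0 →
      IsMinimiser d (sfClass d L N (C.B₃ * ε₁)) L N (k + 1) V U →
        ∀ (x : Site d) (κ : Fin d) (π : T4AveragingDeficitWall.Plane d),
          ‖covGrad U (fun q => ((fhol U q : (Matrix n n ℂ)ˣ) : Matrix n n ℂ)) x κ π‖ ≤ c * ε₁ / ((L : ℝ) ^ (k + 1)) ^ 3) :=
  fun hK => absurd (supKey_letter_floor hd hL hN C hLB hK) (not_le.mpr hc)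

/-! ## §5 THE FREE CEILING: the key with a k-DEPENDENT letter is kinematic -/

/-- ★ **THE SUP KEY WITH THE k-DEPENDENT LETTER `c_k = 2·C.B₃·L^{k+1}` IS FREE** (kinematic, `L ≥ 1`): every minimiser — indeed every member — of
`sfClass (C.B₃ε₁) (k+1)` has `‖∇_U U(∂·)‖ ≤ 2C.B₃ε₁∕(L^{k+1})² = (2C.B₃L^{k+1})·ε₁∕(L^{k+1})³`, in the key's own display.  So the located content of
supKey(C, c) ([Balaban1985Variational] Thm 1 (10) at the (42)-objects) is exactly ONE factor `L^{−(k+1)}` in the letter, uniformly in `k` — the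
regularity-side twin of dag-n16-w2's «(8) at the k-dependent radius» (`…N16SlotKeyFlatModuli.exists8Min_inflated`).  Nothing of node N07 is proved
by this. [cite: Balaban1985Variational, Thm 1 (8)–(10) p.279] -/
theorem supKey_letter_free_ceiling [Nonempty n] {L N : ℕ} (hL : 1 ≤ L) (C : B11Thm1.Consts) :
    ∀ (k : ℕ) (ε₁ : ℝ), 0 < ε₁ → ε₁ ≤ C.a₁ → ∀ (V U : Site d → Fin d → (Matrix n n ℂ)ˣ), V ∈ sfClass d L N ε₁ 0 →
      IsMinimiser d (sfClass d L N (C.B₃ * ε₁)) L N (k + 1) V U →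
        ∀ (x : Site d) (κ : Fin d) (π : T4AveragingDeficitWall.Plane d),
          ‖covGrad U (fun q => ((fhol U q : (Matrix n n ℂ)ˣ) : Matrix n n ℂ)) x κ π‖
            ≤ (2 * C.B₃ * (L : ℝ) ^ (k + 1)) * ε₁ / ((L : ℝ) ^ (k + 1)) ^ 3 := by
  intro k ε₁ _hε _hεa V U _hV hU x κ π
  obtain ⟨hUu, -, hUs⟩ := hU.mem.1
  have hL0 : (0 : ℝ) < (L : ℝ) ^ (k + 1) := by
    have : (0 : ℝ) < L := by exact_mod_cast (show 0 < L by omega)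
    positivity
  have h := covGrad_fhol_le_of_smallField hUu hUs x κ π
  rw [show (2 * C.B₃ * (L : ℝ) ^ (k + 1)) * ε₁ / ((L : ℝ) ^ (k + 1)) ^ 3 = 2 * (C.B₃ * ε₁ / ((L : ℝ) ^ (k + 1)) ^ 2) by
    field_simp]
  exact h

end

end Summit.QuantumFields.YangMills.BalabanUVNodes.N16SupKeyLetterFloor
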